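import Summits.SmoothPoincare4.SmoothPoincare4.Theorems.SymplecticOrigamiOrigamiFoldExistenceHelperRoundSeamRigidity
import Literature.Topology.FourManifolds.CerfGammaFourProofs

/-!
# Line `stable-seam-host` (crux `OrigamiFoldExistence`, stmt-SmoothPoincare4-7844): THE ROUND-SEAM RUNG WITH THE NATURAL ONE-SIDED GERM

Lead c11, cycle 3, brick B.  The landed round-seam rung of STUB 3
(`helper_roundSeamRigidity_of_gromovRecognitionRelEnd`: a homotopy 4-sphere `S` whose fake ball
`(e '' B̊⁴)ᶜ` sits via `J` in a symplectic `(X, Ω)` with ROUND seam germ is `S⁴`, granted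
`GromovRecognitionRelEnd`) asks the round germ `(J ∘ e)^*Ω = κ² (A ∘ ι)^*ω_std` on a TWO-SIDED
annulus `1 - δ < ‖y‖ < 1 + δ` of the chart.  The natural hypothesis constrains `J^*Ω` only where
`J` is given, i.e. just INSIDE the fake ball, on the OUTER collar `e({1 < ‖y‖ < 1 + δ})`.  This
file proves that one-sided version by RESCALING THE CHART BALL: with `c := 1 + δ/2` and the
dilated chart `e' := e ∘ (c • ·)` (again a smooth embedding, `Manifold.IsSmoothEmbedding.comp_diffeomorph`),
the fake ball of `e'` is `(e '' B(0,c))ᶜ ⊆ (e '' B̊⁴)ᶜ`, so the same good open set `U` serves, and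
the scaling law of the inversion `ι(c z) = c⁻¹ ι(z)`, `Dι_{c y}(c v) = c⁻¹ Dι_y(v)`, turns the
one-sided round germ of scale `κ` for `e` into a two-sided round germ of scale `κ / c` for `e'` on
`1 - δ' < ‖y'‖ < 1 + δ'`, `δ' := δ / (4c)` (there `1 + δ/4 < ‖c y'‖ < 1 + 3δ/4`).

* `helper_roundSeamRigidity_outer_of_gromovRecognitionRelEnd` — `GromovRecognitionRelEnd →`
  [the binders and hypotheses of STUB 3, ROUND germ on the outer collar only] `→ S ≅ S⁴`.
No definitions, no named facts beyond the hypothesis `GromovRecognitionRelEnd`, no `sorry`.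
-/

noncomputable section

-- the prescribed namespace `Summit.<P>.<Sub>.…` duplicates `SmoothPoincare4` (P = Sub)
set_option linter.dupNamespace false

open scoped Manifold ContDiff Topology RealInnerProductSpace
open Set Function Metric

namespace Summit.SmoothPoincare4.SmoothPoincare4.Theorems.OrigamiFoldExistence.StableSeamHost

open Literature.Topology.FourManifolds (HomotopySphere)
open Literature.Geometry.Symplectic (inversion stdSymplecticForm)

/-- **Scaling law of the inversion**: `ι (c • z) = c⁻¹ • ι z` for all `c`, `z` (junk values
included: both sides vanish at `c = 0` or `z = 0`). [folklore] -/
private theorem inversion_smul (c : ℝ) (z : EuclideanSpace ℝ (Fin 4)) :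
    inversion (c • z) = c⁻¹ • inversion z := by
  simp only [Literature.Geometry.Symplectic.inversion, norm_smul, Real.norm_eq_abs, smul_smul]
  rcases eq_or_ne c 0 with rfl | hc
  · simp
  rcases eq_or_ne z 0 with rfl | hz
  · simp
  congr 1
  have hz' : ‖z‖ ≠ 0 := norm_ne_zero_iff.2 hz
  rw [mul_pow, sq_abs, mul_inv]
  field_simp

/-- **Scaling law of `Dι`**: `Dι_{c • y} (c • v) = c⁻¹ • Dι_y v` for `c ≠ 0`, `y ≠ 0` (chain
rule applied to `ι ∘ (c • ·) = c⁻¹ • ι`). [folklore] -/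
private theorem fderiv_inversion_smul {c : ℝ} (hc : c ≠ 0) {y : EuclideanSpace ℝ (Fin 4)}
    (hy : y ≠ 0) (v : EuclideanSpace ℝ (Fin 4)) :
    fderiv ℝ inversion (c • y) (c • v) = c⁻¹ • fderiv ℝ inversion y v := by
  have hcy : c • y ≠ 0 := smul_ne_zero hc hy
  have h1 : HasFDerivAt inversion (fderiv ℝ inversion (c • y)) (c • y) :=
    (Literature.Geometry.Symplectic.differentiableAt_inversion hcy).hasFDerivAt
  have h2 : HasFDerivAt (fun z : EuclideanSpace ℝ (Fin 4) => c • z)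
      (c • ContinuousLinearMap.id ℝ (EuclideanSpace ℝ (Fin 4))) y :=
    (hasFDerivAt_id y).const_smul c
  have h3 : HasFDerivAt (inversion ∘ fun z : EuclideanSpace ℝ (Fin 4) => c • z)
      ((fderiv ℝ inversion (c • y)).comp (c • ContinuousLinearMap.id ℝ (EuclideanSpace ℝ (Fin 4))))
      y :=
    h1.comp y h2
  have h4 : HasFDerivAt (fun z : EuclideanSpace ℝ (Fin 4) => c⁻¹ • inversion z)
      (c⁻¹ • fderiv ℝ inversion y) y :=
    (Literature.Geometry.Symplectic.differentiableAt_inversion hy).hasFDerivAt.const_smul c⁻¹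
  have heq : (inversion ∘ fun z : EuclideanSpace ℝ (Fin 4) => c • z) =
      fun z => c⁻¹ • inversion z :=
    funext fun z => inversion_smul c z
  rw [heq] at h3
  have h5 := h3.unique h4
  calc fderiv ℝ inversion (c • y) (c • v)
      = ((fderiv ℝ inversion (c • y)).comp
          (c • ContinuousLinearMap.id ℝ (EuclideanSpace ℝ (Fin 4)))) v := rfl
    _ = (c⁻¹ • fderiv ℝ inversion y) v := by rw [h5]
    _ = c⁻¹ • fderiv ℝ inversion y v := rfl

/-- **THE ROUND-SEAM RUNG OF STUB 3, ONE-SIDED GERM ⇐ `GromovRecognitionRelEnd`.**  Under Gromov's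
recognition of `(ℝ⁴, ω₀)` relative to a standard end (route item stmt-SmoothPoincare4-11009, by
name): if the fake ball `(e '' B̊⁴)ᶜ` of a homotopy 4-sphere `S` sits via `J` in a symplectic
`ℝ⁴`-charted `(X, Ω)` (the rational-host clause is carried, not used) and the seam germ is ROUND
just inside the fake ball — `(J ∘ e)^*Ω = κ² (A ∘ ι)^*ω_std` on the outer collar
`1 < ‖y‖ < 1 + δ` — then `S ≅ S⁴`.  Reduction to the two-sided rung by dilating the chart ball.
[cite: McDuffSalamon2017, Rem. 4.5.2 (viii)] [cite: Gromov1985, §0.3.C] -/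
theorem helper_roundSeamRigidity_outer_of_gromovRecognitionRelEnd :
    Summit.SmoothPoincare4.SmoothPoincare4.Theses.SymplecticOrigami.GromovRecognitionRelEnd → ∀ (S : Literature.Topology.FourManifolds.HomotopySphere 4) (e : EuclideanSpace ℝ (Fin 4) → S.carrier) (X : Type) [TopologicalSpace X] [T2Space X] [SecondCountableTopology X] [CompactSpace X] [ChartedSpace (EuclideanSpace ℝ (Fin 4)) X] [IsManifold (𝓡 4) ∞ X] [SimplyConnectedSpace X] (Ω : Literature.Geometry.Kaehler.MForm (𝓡 4) X ℝ 2) (J : S.carrier → X), Manifold.IsSmoothEmbedding (𝓡 4) (𝓡 4) ∞ e → (Literature.Geometry.Kaehler.IsSmoothForm Ω ∧ Literature.Geometry.Kaehler.IsClosedForm Ω ∧ ∀ x (v : TangentSpace (𝓡 4) x), v ≠ 0 → ∃ w, Ω x ![v, w] ≠ 0) → (∃ U : Set S.carrier, IsOpen U ∧ (e '' Metric.ball (0 : EuclideanSpace ℝ (Fin 4)) 1)ᶜ ⊆ U ∧ ContMDiffOn (𝓡 4) (𝓡 4) ∞ J U ∧ Set.InjOn J U ∧ ∀ x ∈ U,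 Function.Bijective (mfderiv (𝓡 4) (𝓡 4) J x)) → ((∃ c c' : (Metric.sphere (0 : EuclideanSpace ℝ (Fin 3)) 1) → X, (Manifold.IsSmoothEmbedding (𝓡 2) (𝓡 4) ∞ c ∧ (∀ y (v : TangentSpace (𝓡 2) y), v ≠ 0 → ∃ w : TangentSpace (𝓡 2) y, Ω (c y) ![mfderiv (𝓡 2) (𝓡 4) c y v, mfderiv (𝓡 2) (𝓡 4) c y w] ≠ 0) ∧ Manifold.IsSmoothEmbedding (𝓡 2) (𝓡 4) ∞ c' ∧ Disjoint (Set.range c) (Set.range c') ∧ ∃ H : unitInterval × (Metric.sphere (0 : EuclideanSpace ℝ (Fin 3)) 1) → X, Continuous H ∧ ∀ y, H (0, y) = c y ∧ H (1, y) = c' y)) ∨ (∃ (Ψ : X ≃ₘ⟮𝓡 4, 𝓡 4⟯ Literature.Topology.FourManifolds.ComplexProjectivePlane) (a : ℝ), 0 < a ∧ ∀ x (v w : TangentSpace (𝓡 4) x), Ω x ![v, w] = a * Literature.Geometry.Kaehler.CPn.fsForm 2 (Ψ x) ![mfderiv (𝓡 4) (𝓡 4) Ψ x v, mfderiv (𝓡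 4) (𝓡 4) Ψ x w])) → (∃ (κ : ℝ) (A : EuclideanSpace ℝ (Fin 4) ≃ₗᵢ[ℝ] EuclideanSpace ℝ (Fin 4)) (δ : ℝ), 0 < κ ∧ 0 < δ ∧ ∀ y : EuclideanSpace ℝ (Fin 4), 1 < ‖y‖ → ‖y‖ < 1 + δ → ∀ v w : EuclideanSpace ℝ (Fin 4), Ω ((J ∘ e) y) ![mfderiv (𝓡 4) (𝓡 4) (J ∘ e) y v, mfderiv (𝓡 4) (𝓡 4) (J ∘ e) y w] = κ ^ 2 * Literature.Geometry.Symplectic.stdSymplecticForm (A (fderiv ℝ Literature.Geometry.Symplectic.inversion y v)) (A (fderiv ℝ Literature.Geometry.Symplectic.inversion y w))) → Nonempty (S.carrier ≃ₘ⟮𝓡 4, 𝓡 4⟯ Metric.sphere (0 : EuclideanSpace ℝ (Fin 5)) 1) := by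
  intro hG S e X _ _ _ _ _ _ _ Ω J he hΩ hJ hX hround
  obtain ⟨κ, A, δ, hκ, hδ, hR⟩ := hround
  obtain ⟨U, hUo, hΔU, hJU, hJinj, hJbij⟩ := hJ
  -- the scale `c = 1 + δ/2`
  set c : ℝ := 1 + δ / 2 with hc
  have hc1 : 1 < c := by rw [hc]; linarith
  have hc0 : 0 < c := lt_trans one_pos hc1
  have hc0' : c ≠ 0 := hc0.ne'
  have hnorm : ∀ y : EuclideanSpace ℝ (Fin 4), ‖c • y‖ = c * ‖y‖ := fun y => by
    rw [norm_smul, Real.norm_eq_abs, abs_of_pos hc0]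
  -- the dilated chart `e' = e ∘ (c • ·)` is a smooth embedding
  set D : EuclideanSpace ℝ (Fin 4) ≃L[ℝ] EuclideanSpace ℝ (Fin 4) :=
    ContinuousLinearEquiv.smulLeft (Units.mk0 c hc0') with hD
  have hDapp : ∀ y : EuclideanSpace ℝ (Fin 4), D y = c • y := fun y => by
    simp [hD, Units.smul_def]
  have he' : Manifold.IsSmoothEmbedding (𝓡 4) (𝓡 4) ∞
      (fun y : EuclideanSpace ℝ (Fin 4) => e (c • y)) := by
    have h := he.comp_diffeomorph D.toDiffeomorph
    have hfun : (e ∘ ⇑D.toDiffeomorph) = fun y => e (c • y) := by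
      funext y
      simp only [Function.comp_apply, ContinuousLinearEquiv.coe_toDiffeomorph, hDapp]
    rwa [hfun] at h
  -- chart points of norm `> 1` go to the good open set `U`
  have hU1 : ∀ z : EuclideanSpace ℝ (Fin 4), 1 < ‖z‖ → e z ∈ U := by
    intro z hz
    refine hΔU ?_
    rintro ⟨x, hx, hxz⟩
    rw [he.isEmbedding.injective hxz] at hx
    have : ‖z‖ < 1 := by simpa using hx
    linarith
  refine helper_roundSeamRigidity_of_gromovRecognitionRelEnd hG S
    (fun y : EuclideanSpace ℝ (Fin 4) => e (c • y)) X Ω J he' hΩ ?_ hX ?_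
  · -- the fake ball of `e'` is smaller: `(e' '' B̊)ᶜ = (e '' B(0, c))ᶜ ⊆ (e '' B̊)ᶜ ⊆ U`
    refine ⟨U, hUo, ?_, hJU, hJinj, hJbij⟩
    intro x hx
    refine hΔU ?_
    rintro ⟨z, hz, rfl⟩
    have hz1 : ‖z‖ < 1 := by simpa using hz
    have h1 : c⁻¹ • z ∈ ball (0 : EuclideanSpace ℝ (Fin 4)) 1 := by
      rw [mem_ball_zero_iff, norm_smul, Real.norm_eq_abs, abs_of_pos (inv_pos.2 hc0)]
      exact lt_of_le_of_lt (mul_le_of_le_one_left (norm_nonneg _) (inv_le_one_of_one_le₀ hc1.le))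
        hz1
    have h2 : (fun y : EuclideanSpace ℝ (Fin 4) => e (c • y)) (c⁻¹ • z) = e z := by
      show e (c • c⁻¹ • z) = e z
      rw [smul_smul, mul_inv_cancel₀ hc0', one_smul]
    exact hx ⟨c⁻¹ • z, h1, h2⟩
  · -- the TWO-SIDED round germ for `e'`: scale `κ / c`, width `δ / (4c)`
    refine ⟨κ / c, A, δ / (4 * c), div_pos hκ hc0, by positivity, ?_⟩
    intro y hy1 hy2 v w
    have hcδ : c * (δ / (4 * c)) = δ / 4 := by field_simp
    have hlow : 1 < c * (1 - δ / (4 * c)) := by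
      rw [mul_sub, hcδ, mul_one, hc]; linarith
    have hup : c * (1 + δ / (4 * c)) < 1 + δ := by
      rw [mul_add, hcδ, mul_one, hc]; linarith
    -- `c • y` lies in the outer collar
    have hz1 : 1 < ‖c • y‖ := by
      rw [hnorm]; exact hlow.trans (mul_lt_mul_of_pos_left hy1 hc0)
    have hz2 : ‖c • y‖ < 1 + δ := by
      rw [hnorm]; exact (mul_lt_mul_of_pos_left hy2 hc0).trans hup
    have hy0 : y ≠ 0 := by
      intro h; rw [h, smul_zero, norm_zero] at hz1; linarith
    -- differentiability of `J ∘ e` at `c • y`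
    have heU : e (c • y) ∈ U := hU1 _ hz1
    have hJd : MDifferentiableAt (𝓡 4) (𝓡 4) J (e (c • y)) :=
      ((hJU _ heU).contMDiffAt (hUo.mem_nhds heU)).mdifferentiableAt (by simp)
    have hed : MDifferentiableAt (𝓡 4) (𝓡 4) e (c • y) :=
      (he.contMDiff (c • y)).mdifferentiableAt (by simp)
    have hJed : MDifferentiableAt (𝓡 4) (𝓡 4) (J ∘ e) (c • y) := hJd.comp (c • y) hed
    -- the chain rule through the dilation `c • ·`
    have hsd : HasMFDerivAt (𝓡 4) (𝓡 4) (fun z : EuclideanSpace ℝ (Fin 4) => c • z) y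
        (c • ContinuousLinearMap.id ℝ (EuclideanSpace ℝ (Fin 4))) :=
      ((hasFDerivAt_id y).const_smul c).hasMFDerivAt
    have hcomp : HasMFDerivAt (𝓡 4) (𝓡 4)
        ((J ∘ e) ∘ fun z : EuclideanSpace ℝ (Fin 4) => c • z) y
        ((mfderiv (𝓡 4) (𝓡 4) (J ∘ e) (c • y)).comp
          (c • ContinuousLinearMap.id ℝ (EuclideanSpace ℝ (Fin 4)))) :=
      hJed.hasMFDerivAt.comp y hsd
    have hmf : ∀ u : EuclideanSpace ℝ (Fin 4),
        mfderiv (𝓡 4) (𝓡 4) (J ∘ fun z : EuclideanSpace ℝ (Fin 4) => e (c • z)) y u =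
          mfderiv (𝓡 4) (𝓡 4) (J ∘ e) (c • y) (c • u) := by
      intro u
      have hfe : (J ∘ fun z : EuclideanSpace ℝ (Fin 4) => e (c • z)) =
          ((J ∘ e) ∘ fun z : EuclideanSpace ℝ (Fin 4) => c • z) := rfl
      rw [hfe, hcomp.mfderiv]
      rfl
    -- bilinearity of `ω_std` in scalars
    have hω : ∀ (t : ℝ) (a b : EuclideanSpace ℝ (Fin 4)),
        stdSymplecticForm (t • a) (t • b) = t ^ 2 * stdSymplecticForm a b := by
      intro t a b
      simp only [Literature.Geometry.Symplectic.stdSymplecticForm, PiLp.smul_apply, smul_eq_mul]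
      ring
    have key := hR (c • y) hz1 hz2 (c • v) (c • w)
    calc Ω ((J ∘ e) (c • y))
          ![mfderiv (𝓡 4) (𝓡 4) (J ∘ fun z : EuclideanSpace ℝ (Fin 4) => e (c • z)) y v,
            mfderiv (𝓡 4) (𝓡 4) (J ∘ fun z : EuclideanSpace ℝ (Fin 4) => e (c • z)) y w]
        = Ω ((J ∘ e) (c • y)) ![mfderiv (𝓡 4) (𝓡 4) (J ∘ e) (c • y) (c • v),
            mfderiv (𝓡 4) (𝓡 4) (J ∘ e) (c • y) (c • w)] := by rw [hmf v, hmf w]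
      _ = κ ^ 2 * stdSymplecticForm (A (fderiv ℝ inversion (c • y) (c • v)))
            (A (fderiv ℝ inversion (c • y) (c • w))) := key
      _ = (κ / c) ^ 2 * stdSymplecticForm (A (fderiv ℝ inversion y v))
            (A (fderiv ℝ inversion y w)) := by
          rw [fderiv_inversion_smul hc0' hy0 v, fderiv_inversion_smul hc0' hy0 w, A.map_smul,
            A.map_smul, hω]
          ring

end Summit.SmoothPoincare4.SmoothPoincare4.Theorems.OrigamiFoldExistence.StableSeamHost

end
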